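import Literature.MathematicalPhysics.QuantumManyBody.BoseGasConfigLineGap
import Literature.MathematicalPhysics.QuantumManyBody.BoseGasFreeProductState
import Literature.MathematicalPhysics.QuantumManyBody.PeriodicBoseGasScattering
import Literature.MathematicalPhysics.QuantumManyBody.BoseGasDirichletWall
import HarnessLib

/-!
# Wall depletion at a fixed distance for Dirichlet near-minimisers: zero scattering length

Topic `Literature/MathematicalPhysics/QuantumManyBody`, namespace `…BoseGas`; the companion of
`BoseGasSlabDepletion.lean` (positive scattering length) for potentials with scattering length
`a = 0`, i.e. `v = 0` almost everywhere on `ℝ³` (`LSSY2005_zeroScatteringLength_holds`,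
[LSSY2005, App. C]).  There the interaction is invisible to the energy functional
(`lintegral_interaction_mul_eq_zero`: the pair sets `{v(|xᵢ - xⱼ|) ≠ 0}` are Lebesgue null, so
`energy v Ψ = ∫|∇Ψ|²` and `E₀^D(v, N, L) = E₀^D(0, N, L)`), and the mechanism is the free
Dirichlet gap: by `BoseGasConfigLineGap.lean` a state `Φ` of the box `Λ_{L'}` has
`3λ · #{slab} + 6λN ≤ (4π²s³/L'³)λN + 2∫|∇Φ|²` (`λ = (π/L')²`), while by
`BoseGasFreeProductState.lean` the free ground-state energy is `≤ 3Nλ(1 + η)` for large boxes; a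
`1`-near-minimiser therefore has at most `(4π²s³/(3L'³) + 2η)N + 2L'²/(3π²)` particles in the
slab, which is `≤ θN` eventually along the thermodynamic window `L' ∈ [L_N, (1+κ/N)L_N]`
(`slabNonConcentration_of_scatteringLength_eq_zero`).  No density restriction is needed in
this case.  No definitions.

## References

* [LSSY2005] E. H. Lieb, R. Seiringer, J. P. Solovej, J. Yngvason, *The Mathematics of the Bose
  Gas and its Condensation* (2005), Ch. 2 (2.3), App. C (zero scattering length).
-/

noncomputable section

namespace Literature.MathematicalPhysics.QuantumManyBody.BoseGas

open _root_.MeasureTheory _root_.Filter _root_.Set _root_.Real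
open scoped ENNReal NNReal Topology BigOperators

variable {v : ℝ → ℝ≥0∞}

/-! ### An almost everywhere vanishing potential is invisible -/

/-- The pair set `{X | v(|xᵢ - xⱼ|) ≠ 0}` is Lebesgue null if `v(|·|) = 0` a.e. on `ℝ³`. [folklore] -/
theorem volume_pair_ne_zero_eq_zero (hv : Measurable v) (hae : ∀ᵐ x : Space, v ‖x‖ = 0) {n : ℕ}
    {i j : Fin (n + 1)} (hij : j ≠ i) :
    volume {X : Config (n + 1) | v (dist (X i) (X j)) ≠ 0} = 0 := by
  set w : ℝ → ℝ≥0∞ := {r | v r ≠ 0}.indicator 1 with hw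
  have hwm : Measurable w := measurable_one.indicator (hv (measurableSet_singleton 0).compl)
  have hS : MeasurableSet {X : Config (n + 1) | v (dist (X i) (X j)) ≠ 0} :=
    (hv.comp ((measurable_pi_apply i).dist (measurable_pi_apply j))) (measurableSet_singleton 0).compl
  have h := lintegral_removeNth_mul_pair (v := w) hij hwm (G := fun _ => 1) measurable_const
  have hw0 : ∫⁻ x : Space, w ‖x‖ = 0 := by
    refine (lintegral_eq_zero_iff (hwm.comp measurable_norm)).2 ?_
    filter_upwards [hae] with x hx
    simp [hw, hx]
  rw [hw0, zero_mul] at h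
  rw [← lintegral_indicator_one hS]
  refine Eq.trans (lintegral_congr fun X => ?_) h
  rw [one_mul]
  simp only [hw]
  by_cases hX : v (dist (X i) (X j)) ≠ 0
  · rw [indicator_of_mem (show X ∈ {X : Config (n + 1) | v (dist (X i) (X j)) ≠ 0} from hX),
      indicator_of_mem (show dist (X i) (X j) ∈ {r | v r ≠ 0} from hX)]
    simp only [Pi.one_apply]
  · rw [indicator_of_notMem (show X ∉ {X : Config (n + 1) | v (dist (X i) (X j)) ≠ 0} from hX),
      indicator_of_notMem (show dist (X i) (X j) ∉ {r | v r ≠ 0} from hX)]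

/-- **An a.e. vanishing potential is invisible to the energy functional**:
`∫ (∑_{i<j} v(|xᵢ - xⱼ|)) F = 0` for every `F`. [folklore] -/
theorem lintegral_interaction_mul_eq_zero (hv : Measurable v) (hae : ∀ᵐ x : Space, v ‖x‖ = 0)
    {N : ℕ} (F : Config N → ℝ≥0∞) : ∫⁻ X, interaction v X * F X = 0 := by
  rcases Nat.eq_zero_or_pos N with rfl | hN
  · simp [interaction]
  obtain ⟨n, rfl⟩ : ∃ n, N = n + 1 := ⟨N - 1, by omega⟩
  have hnull : volume {X : Config (n + 1) | interaction v X ≠ 0} = 0 := by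
    have hsub : {X : Config (n + 1) | interaction v X ≠ 0} ⊆
        ⋃ i : Fin (n + 1), ⋃ j : Fin (n + 1), {X | j ≠ i ∧ v (dist (X i) (X j)) ≠ 0} := by
      intro X hX
      simp only [Set.mem_setOf_eq, interaction] at hX
      obtain ⟨i, -, hi⟩ := Finset.exists_ne_zero_of_sum_ne_zero hX
      obtain ⟨j, hj, hij⟩ := Finset.exists_ne_zero_of_sum_ne_zero hi
      refine Set.mem_iUnion.2 ⟨i, Set.mem_iUnion.2 ⟨j, (Finset.mem_filter.1 hj).2.ne', hij⟩⟩
    refine measure_mono_null hsub (measure_iUnion_null fun i => measure_iUnion_null fun j => ?_)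
    by_cases hji : j = i
    · have : {X : Config (n + 1) | j ≠ i ∧ v (dist (X i) (X j)) ≠ 0} = ∅ := by
        ext X; simp [hji]
      rw [this]; exact measure_empty
    · have := volume_pair_ne_zero_eq_zero hv hae (n := n) hji
      refine measure_mono_null (fun X hX => hX.2) this
  refine lintegral_eq_zero_of_ae_eq_zero ?_
  rw [Filter.EventuallyEq, ae_iff]
  refine measure_mono_null (fun X hX => ?_) hnull
  simp only [Pi.zero_apply, mul_eq_zero, not_or, Set.mem_setOf_eq] at hX ⊢
  exact hX.1

/-- Hence `energy v Ψ = ∫|∇Ψ|²` and `E₀^D(v, N, L) = E₀^D(0, N, L)`. [cite: LSSY2005, App. C] -/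
theorem energy_eq_lintegral_kineticDensity (hv : Measurable v) (hae : ∀ᵐ x : Space, v ‖x‖ = 0)
    {N : ℕ} {L : ℝ} (Ψ : TrialState N L) : energy v Ψ = ∫⁻ X, kineticDensity Ψ.ψ X := by
  rw [energy, lintegral_add_left (measurable_kineticDensity Ψ.contDiff),
    lintegral_interaction_mul_eq_zero hv hae, add_zero]

/-- The ground-state energies of an invisible potential are the free ones. [cite: LSSY2005, App. C] -/
theorem groundStateEnergy_eq_zero_potential (hv : Measurable v) (hae : ∀ᵐ x : Space, v ‖x‖ = 0)
    (N : ℕ) (L : ℝ) : groundStateEnergy v N L = groundStateEnergy 0 N L := by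
  unfold groundStateEnergy
  refine iInf_congr fun Ψ => ?_
  rw [energy_eq_lintegral_kineticDensity hv hae,
    energy_eq_lintegral_kineticDensity (v := 0) measurable_const (ae_of_all _ fun _ => rfl)]

/-! ### The free slab bound -/

/-- **The free slab bound for a state of bounded kinetic excess.**  If a Dirichlet trial state `Φ`
of `Λ_L` (`L > 0`, `N` particles) has `∫|∇Φ|² ≤ ofReal (3N(π/L)²(1+η)) + 1`, then for `0 < s ≤ L`,
`∑ⱼ ∫_{x_{j,a} > L-s}|Φ|² ≤ ofReal ((4π²s³/(3L³) + 2η) N + 2L²/(3π²))`. [cite: LSSY2005, Ch. 2 (2.3)] -/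
theorem slab_le_of_kinetic_excess {N : ℕ} {L : ℝ} (hL : 0 < L) (Φ : TrialState N L) {η : ℝ} (hη : 0 ≤ η)
    (hT : ∫⁻ X, kineticDensity Φ.ψ X ≤ ENNReal.ofReal (3 * N * (π / L) ^ 2 * (1 + η)) + 1)
    (a : Fin 3) {s : ℝ} (hs : 0 < s) (hsL : s ≤ L) :
    (∑ j : Fin N, ∫⁻ X in {X : Config N | L - s < X j a}, ((‖Φ.ψ X‖₊ : ℝ≥0∞)) ^ 2) ≤
      ENNReal.ofReal ((4 * π ^ 2 * s ^ 3 / (3 * L ^ 3) + 2 * η) * N + 2 * L ^ 2 / (3 * π ^ 2)) := by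
  have h1raw := slab_gap_config hL Φ a hs hsL
  set lam : ℝ := (π / L) ^ 2 with hlam
  have hlam0 : 0 < lam := by positivity
  set Sl := ∑ j : Fin N, ∫⁻ X in {X : Config N | L - s < X j a}, ((‖Φ.ψ X‖₊ : ℝ≥0∞)) ^ 2 with hSl
  set T : Fin 3 → ℝ≥0∞ := fun b => ∑ j : Fin N, ∫⁻ X, (‖fderiv ℝ Φ.ψ X (unitVec j b)‖₊ : ℝ≥0∞) ^ 2 with hTb
  have h1 : ENNReal.ofReal (3 * lam) * Sl + ENNReal.ofReal (2 * lam) * N ≤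
      ENNReal.ofReal (4 * π ^ 2 * s ^ 3 / L ^ 3 * lam) * N + 2 * T a := h1raw
  have h2 : ∀ b, ENNReal.ofReal lam * N ≤ T b := fun b => ofReal_mul_card_le_directionalEnergy hL Φ b
  have h3 : ∑ b, T b = ∫⁻ X, kineticDensity Φ.ψ X := sum_directionalEnergy_eq Φ.contDiff
  -- `3λ Sl + 6λ N ≤ κλ N + 2 ∑_b T_b`
  have hsum : ENNReal.ofReal (3 * lam) * Sl + ENNReal.ofReal (6 * lam) * N ≤
      ENNReal.ofReal (4 * π ^ 2 * s ^ 3 / L ^ 3 * lam) * N + 2 * ∑ b, T b := by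
    have hrest : 2 * ∑ b ∈ Finset.univ.erase a, ENNReal.ofReal lam * (N : ℝ≥0∞) ≤
        2 * ∑ b ∈ Finset.univ.erase a, T b :=
      mul_le_mul_right (Finset.sum_le_sum fun b _ => h2 b) _
    have hcard : (Finset.univ.erase a).card = 2 := by
      rw [Finset.card_erase_of_mem (Finset.mem_univ a)]; simp
    rw [Finset.sum_const, hcard] at hrest
    have hsplit : ∑ b, T b = T a + ∑ b ∈ Finset.univ.erase a, T b :=
      (Finset.add_sum_erase Finset.univ T (Finset.mem_univ a)).symm
    have h6 : ENNReal.ofReal (6 * lam) * (N : ℝ≥0∞) =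
        ENNReal.ofReal (2 * lam) * N + 2 * (2 • (ENNReal.ofReal lam * (N : ℝ≥0∞))) := by
      rw [ENNReal.ofReal_mul (p := 6) (by norm_num), ENNReal.ofReal_mul (p := 2) (by norm_num),
        ENNReal.ofReal_ofNat, ENNReal.ofReal_ofNat, nsmul_eq_mul]
      push_cast; ring
    calc ENNReal.ofReal (3 * lam) * Sl + ENNReal.ofReal (6 * lam) * N
        = (ENNReal.ofReal (3 * lam) * Sl + ENNReal.ofReal (2 * lam) * N) +
            2 * (2 • (ENNReal.ofReal lam * (N : ℝ≥0∞))) := by rw [h6, ← add_assoc]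
      _ ≤ (ENNReal.ofReal (4 * π ^ 2 * s ^ 3 / L ^ 3 * lam) * N + 2 * T a) +
            2 * ∑ b ∈ Finset.univ.erase a, T b := add_le_add h1 hrest
      _ = ENNReal.ofReal (4 * π ^ 2 * s ^ 3 / L ^ 3 * lam) * N + 2 * ∑ b, T b := by
          rw [hsplit, mul_add, add_assoc]
  -- insert the kinetic bound and cancel `6λN`
  have hNlam : ENNReal.ofReal (6 * lam) * (N : ℝ≥0∞) = ENNReal.ofReal (6 * N * lam) := by
    rw [show (6 : ℝ) * N * lam = 6 * lam * N by ring, ENNReal.ofReal_mul (p := 6 * lam) (by positivity),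
      ENNReal.ofReal_natCast]
  have hkin : 2 * ∑ b, T b ≤ ENNReal.ofReal (6 * N * lam) + ENNReal.ofReal (6 * N * lam * η) + 2 := by
    rw [h3]
    calc 2 * ∫⁻ X, kineticDensity Φ.ψ X ≤ 2 * (ENNReal.ofReal (3 * N * (π / L) ^ 2 * (1 + η)) + 1) :=
          mul_le_mul_right hT _
      _ = ENNReal.ofReal (6 * N * lam) + ENNReal.ofReal (6 * N * lam * η) + 2 := by
          rw [mul_add, mul_one, ← ENNReal.ofReal_ofNat 2, ← ENNReal.ofReal_mul (by norm_num),
            show (2 : ℝ) * (3 * N * (π / L) ^ 2 * (1 + η)) = 6 * N * lam + 6 * N * lam * η by rw [hlam]; ring,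
            ENNReal.ofReal_add (by positivity) (by positivity), ENNReal.ofReal_ofNat]
  have hmain : ENNReal.ofReal (3 * lam) * Sl ≤
      ENNReal.ofReal (4 * π ^ 2 * s ^ 3 / L ^ 3 * lam) * N + ENNReal.ofReal (6 * N * lam * η) + 2 := by
    have h := hsum.trans (add_le_add le_rfl hkin)
    rw [hNlam] at h
    refine ENNReal.le_of_add_le_add_right (a := ENNReal.ofReal (6 * N * lam)) ENNReal.ofReal_ne_top ?_
    calc ENNReal.ofReal (3 * lam) * Sl + ENNReal.ofReal (6 * N * lam) ≤ _ := h
      _ = _ := by ring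
  -- divide by `3λ`
  have h3lam : ENNReal.ofReal (3 * lam) ≠ 0 := by simpa using (by positivity : 0 < 3 * lam)
  rw [← ENNReal.mul_le_mul_iff_right h3lam ENNReal.ofReal_ne_top]
  have hE : ENNReal.ofReal (3 * lam) *
      ENNReal.ofReal ((4 * π ^ 2 * s ^ 3 / (3 * L ^ 3) + 2 * η) * N + 2 * L ^ 2 / (3 * π ^ 2)) =
      ENNReal.ofReal (4 * π ^ 2 * s ^ 3 / L ^ 3 * lam) * N + ENNReal.ofReal (6 * N * lam * η) + 2 := by
    rw [← ENNReal.ofReal_mul (by positivity),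
      show 3 * lam * ((4 * π ^ 2 * s ^ 3 / (3 * L ^ 3) + 2 * η) * N + 2 * L ^ 2 / (3 * π ^ 2)) =
        4 * π ^ 2 * s ^ 3 / L ^ 3 * lam * N + 6 * N * lam * η + 2 by rw [hlam]; field_simp; ring,
      ENNReal.ofReal_add (by positivity) (by norm_num), ENNReal.ofReal_add (by positivity) (by positivity),
      ENNReal.ofReal_mul (p := 4 * π ^ 2 * s ^ 3 / L ^ 3 * lam) (by positivity), ENNReal.ofReal_natCast,
      ENNReal.ofReal_ofNat]
  rw [hE]
  exact hmain

/-- **Wall depletion at a fixed distance (zero scattering length).**  For a repulsive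
finite-range `v` with `a = 0`, every density `ρ > 0`, every `0 < s ≤ 1`, `θ > 0` and real `κ`:
eventually in `N`, for every `L' ∈ [L_N, (1+κ/N)L_N]`, every Dirichlet trial state `Φ` of `N`
bosons in `Λ_{L'}` with `⟨Φ,HΦ⟩ ≤ E₀^D(N, L') + 1` and every direction `a`,
`∑ⱼ ∫_{x_{j,a} > L'-s} |Φ|² ≤ θN`. [cite: LSSY2005, Ch. 2 (2.3), App. C] -/
theorem slabNonConcentration_of_scatteringLength_eq_zero (hv : IsRepulsiveFiniteRange v)
    (ha0 : scatteringLength v = 0) {ρ : ℝ} (hρ : 0 < ρ) {s : ℝ} (hs : 0 < s) (hs1 : s ≤ 1) {θ : ℝ}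
    (hθ : 0 < θ) (κ : ℝ) :
    ∀ᶠ N : ℕ in atTop, ∀ L' ∈ Set.Icc (sideLength ρ N) ((1 + κ / N) * sideLength ρ N),
      ∀ Φ : TrialState N L', energy v Φ ≤ groundStateEnergy v N L' + 1 →
        ∀ a : Fin 3, (∑ j : Fin N, ∫⁻ X in {X : Config N | L' - s < X j a},
          ((‖Φ.ψ X‖₊ : ℝ≥0∞)) ^ 2) ≤ ENNReal.ofReal (θ * N) := by
  obtain ⟨R₀, hR₀⟩ := hv.2
  have hae : ∀ᵐ x : Space, v ‖x‖ = 0 := LSSY2005_zeroScatteringLength_holds v R₀ hv.1 hR₀ ha0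
  set η : ℝ := θ / 4 with hη
  have hη0 : 0 < η := by positivity
  obtain ⟨L₀, hL₀, Hfree⟩ := groundStateEnergy_zero_le_of_ge hη0
  have hE1 : ∀ᶠ N : ℕ in atTop, max L₀ 1 ≤ sideLength ρ N := (tendsto_sideLength_atTop hρ).eventually_ge_atTop _
  have hE2 : ∀ᶠ N : ℕ in atTop, 32 / (3 * π ^ 2 * ρ * θ) ≤ sideLength ρ N :=
    (tendsto_sideLength_atTop hρ).eventually_ge_atTop _
  have hE3 : ∀ᶠ N : ℕ in atTop, max κ (16 * π ^ 2 * ρ / (3 * θ)) ≤ (N : ℝ) :=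
    tendsto_natCast_atTop_atTop.eventually_ge_atTop _
  filter_upwards [hE1, hE2, hE3, eventually_gt_atTop 0] with N hN1 hN2 hN3 hN0 L' hL' Φ hΦ a
  have hNr : (0 : ℝ) < N := Nat.cast_pos.2 hN0
  have hLN : 0 < sideLength ρ N := sideLength_pos_of_pos hρ hN0
  obtain ⟨hL'lo, hL'hi⟩ := hL'
  have hL'0 : 0 < L' := hLN.trans_le hL'lo
  have hκN : κ ≤ N := (le_max_left _ _).trans hN3
  have hNbig : 16 * π ^ 2 * ρ / (3 * θ) ≤ N := (le_max_right _ _).trans hN3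
  have hL₀L : L₀ ≤ L' := ((le_max_left _ _).trans hN1).trans hL'lo
  have h1L : 1 ≤ L' := ((le_max_right _ _).trans hN1).trans hL'lo
  have hL'2 : L' ≤ 2 * sideLength ρ N := by
    have : κ / N ≤ 1 := (div_le_one hNr).2 hκN
    refine hL'hi.trans ?_; nlinarith
  -- the kinetic excess of the near-minimiser
  have hT : ∫⁻ X, kineticDensity Φ.ψ X ≤ ENNReal.ofReal (3 * N * (π / L') ^ 2 * (1 + η)) + 1 := by
    rw [← energy_eq_lintegral_kineticDensity hv.1 hae Φ]
    refine hΦ.trans (add_le_add ?_ le_rfl)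
    rw [groundStateEnergy_eq_zero_potential hv.1 hae]
    exact Hfree L' hL₀L N
  have hslab := slab_le_of_kinetic_excess hL'0 Φ hη0.le hT a hs (hs1.trans h1L)
  refine hslab.trans (ENNReal.ofReal_le_ofReal ?_)
  -- the three terms
  have h3 : sideLength ρ N ^ 3 = N / ρ := sideLength_pow_three hρ N
  have hNρ : (N : ℝ) = ρ * sideLength ρ N ^ 3 := by rw [h3]; field_simp
  have ht1 : 4 * π ^ 2 * s ^ 3 / (3 * L' ^ 3) * N ≤ θ * N / 4 := by
    have hs3 : s ^ 3 ≤ 1 := pow_le_one₀ hs.le hs1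
    have hL3 : sideLength ρ N ^ 3 ≤ L' ^ 3 := pow_le_pow_left₀ hLN.le hL'lo 3
    have hfrac : (N : ℝ) / L' ^ 3 ≤ ρ := by
      rw [div_le_iff₀ (by positivity), hNρ]; exact mul_le_mul_of_nonneg_left hL3 hρ.le
    have hθN : 16 * π ^ 2 * ρ ≤ 3 * θ * N := by
      rw [div_le_iff₀ (by positivity)] at hNbig; linarith
    calc 4 * π ^ 2 * s ^ 3 / (3 * L' ^ 3) * N = 4 * π ^ 2 / 3 * s ^ 3 * (N / L' ^ 3) := by
          field_simp
      _ ≤ 4 * π ^ 2 / 3 * 1 * ρ := by gcongr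
      _ ≤ θ * N / 4 := by nlinarith
  have ht2 : 2 * η * N = θ * N / 2 := by rw [hη]; ring
  have ht3 : 2 * L' ^ 2 / (3 * π ^ 2) ≤ θ * N / 4 := by
    have hL2 : L' ^ 2 ≤ 4 * sideLength ρ N ^ 2 :=
      calc L' ^ 2 ≤ (2 * sideLength ρ N) ^ 2 := pow_le_pow_left₀ hL'0.le hL'2 2
        _ = 4 * sideLength ρ N ^ 2 := by ring
    have h32 : 32 ≤ sideLength ρ N * (3 * π ^ 2 * ρ * θ) := (div_le_iff₀ (by positivity)).1 hN2
    rw [div_le_iff₀ (by positivity), hNρ]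
    nlinarith [pow_pos hLN 2, mul_pos hρ hθ]
  nlinarith

end Literature.MathematicalPhysics.QuantumManyBody.BoseGas

end
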